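import Mathlib
import Summits.NavierStokesRegularity.NavierStokesRegularity.Theorems.LevelSetModerationHighSpeedPressureWorkPairingOfPressureBound
import Summits.NavierStokesRegularity.NavierStokesRegularity.Theorems.LevelSetModerationModerationIdentity

/-!
# Route LevelSetModeration — `HighSpeedPressureWork`: the pairing bound from a MODERATED pressure bound

Support file for item stmt-NavierStokesRegularity-18149 (`HighSpeedPressureWork`), line
`line-iso-speed-area-closure` (infrastructure for the early-window bookkeeping). The landed
`levelSetModeration_pairing_le_of_pressureBound` turns a pointwise bound `|p̃[u τ]| ≤ K` on the fast
set `{c < |u τ|}` into the pairing bound `PW_c ≤ √(K² V_c(T)) √(D_c(T))` of the crux. This file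
proves its **moderated twin** (Tran–Yu pressure moderation in the De Giorgi pairing): the same
conclusion from a bound on the OSCILLATION `|p̃[u τ](x) - Φ(τ)| ≤ K` on the fast set, with a free
constant `Φ(τ)` per time slice.

The moderation step is the observation that the pressure work `-∫ (1 - c/|v|)₊ Dq(x)(v x) dx`
only sees the gradient of the slice pressure `q`, and `D(q - Φ₀) = Dq` for a constant `Φ₀`
(equivalently, in the integrated-by-parts form `∫ 1_A (c/|v|²)(D|v|(v)) q` of `stub_levelSetIBP`,
the flux-weighted integral of the constant `Φ₀` over `A = {c < |v|}` vanishes — the landed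
`ModerationIdentity` with the constant moderator `g = Φ₀`). Hence the unmoderated slice bound
`levelSetModeration_slicePairing_le_of_pressureBound` applied to `q - Φ₀` gives

* `levelSetModeration_moderatedSlicePairing_le` — one slice:
  `-∫ (1 - c/|v|)₊ Dq(v) ≤ K ∫ 1_{c<|v|} ‖D|v|‖` whenever `|q - Φ₀| ≤ K` on `{c < |v|}`;
* `levelSetModeration_moderatedPairing_le` — integrated in time for a classical Leray–Hopf
  solution, exactly as in the unmoderated file: `PW ≤ K 𝒟¹_c(T) ≤ √(K² V_c(T)) √(D_c(T))`
  (`levelSetModeration_isoSpeedArea_le_sqrt`);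
* `levelSetModeration_pairing_le_of_moderatedPressureBound` — the registered closed form.
-/

noncomputable section

-- single-conjunct summit: `Summit.<Summit>.<Problem>` repeats the name by the D-0017 layout
set_option linter.dupNamespace false

namespace Summit.NavierStokesRegularity.NavierStokesRegularity.Theorems

open MeasureTheory Set Filter Topology
open scoped ENNReal
open Literature.Analysis.FluidPDE

/-! ### One slice: the pairing is bounded by `K` times the area slice, moderated form -/

/-- **Moderated slice pairing bound.** For `v ∈ C¹(ℝ³; ℝ³)` divergence free with bounded
`{c < |v|}` (`c > 0`), `q ∈ C¹(ℝ³)` and a constant `Φ₀` with `|q - Φ₀| ≤ K` on `{c < |v|}`: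
`-∫ (1 - c/|v|)₊ Dq(x)(v x) dx ≤ K ∫ 1_{c<|v|} ‖D|v|(x)‖ dx`. The pairing only involves `Dq`, and
`D(q - Φ₀) = Dq`, so this is `levelSetModeration_slicePairing_le_of_pressureBound` for `q - Φ₀`
(Tran–Yu moderation by a constant; in IBP form the constant's flux-weighted integral over the fast
set vanishes, `ModerationIdentity`). [folklore] -/
theorem levelSetModeration_moderatedSlicePairing_le
    {v : EuclideanSpace ℝ (Fin 3) → EuclideanSpace ℝ (Fin 3)} {q : EuclideanSpace ℝ (Fin 3) → ℝ}
    {c K Φ₀ : ℝ} (hc : 0 < c) (hv : ContDiff ℝ 1 v) (hq : ContDiff ℝ 1 q)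
    (hdiv : VectorCalculus.IsDivFree v) (hbdd : Bornology.IsBounded {x | c < ‖v x‖})
    (hK : ∀ x, c < ‖v x‖ → |q x - Φ₀| ≤ K) :
    -(∫ x, max (1 - c / ‖v x‖) 0 * (fderiv ℝ q x (v x))) ≤
      K * (∫⁻ x, {x | c < ‖v x‖}.indicator
        (fun x => ENNReal.ofReal ‖fderiv ℝ (fun y => ‖v y‖) x‖) x).toReal := by
  have h := levelSetModeration_slicePairing_le_of_pressureBound (q := fun x => q x - Φ₀) hc hv
    (hq.sub contDiff_const) hdiv hbdd hK
  simpa only [fderiv_sub_const] using h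

/-! ### Integrated in time -/

/-- **The pairing bound from a moderated pressure bound on the fast set.** Let `u` be a classical
solution of unforced Navier–Stokes on `ℝ³ × [0,T)` (`ν, T > 0`), Leray–Hopf from a rapidly
decaying datum, `c > 0`, `0 ≤ s`, `t ∈ [0,T)`, `K ≥ 0`, `Φ : ℝ → ℝ` arbitrary. If
`|p̃[u τ](x) - Φ(τ)| ≤ K` at every `τ ∈ (s,t)` and every fast point `c < |u τ x|`, then
`-∫ₛᵗ∫ (1 - c/|u|)₊ D(p̃[u τ])(u) ≤ √(K² V_c(T)) √(D_c(T))`: slice by slice the pairing is at most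
`K ∫ 1_{c<|u|} ‖D|u|‖` (`levelSetModeration_moderatedSlicePairing_le`; the slices `p̃[u τ]` are
`C^∞`, `levelSetModeration_contDiff_normalisedPressure_slice`), the time integral of the area
slices is `≤ 𝒟¹_c(T) < ∞`, and `𝒟¹_c(T) ≤ √(V_c(T)) √(D_c(T))`
(`levelSetModeration_isoSpeedArea_le_sqrt`). [folklore] -/
theorem levelSetModeration_moderatedPairing_le {ν T : ℝ}
    {u : ℝ → EuclideanSpace ℝ (Fin 3) → EuclideanSpace ℝ (Fin 3)}
    {p : ℝ → EuclideanSpace ℝ (Fin 3) → ℝ} (hν : 0 < ν) (hT : 0 < T)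
    (hcl : IsClassicalNSSolutionOn (Ico 0 T) ν 0 u p) (hLH : IsLerayHopfOn T ν 0 (u 0) u)
    (hdec : HasRapidSpatialDecay (u 0)) {c s t K : ℝ} {Φ : ℝ → ℝ} (hc : 0 < c) (hs : 0 ≤ s)
    (ht : t ∈ Ico 0 T) (hK0 : 0 ≤ K)
    (hK : ∀ τ ∈ Ioo s t, ∀ x, c < ‖u τ x‖ → |normalisedPressure (u τ) x - Φ τ| ≤ K) :
    -(∫ τ in Ioo s t, ∫ x, max (1 - c / ‖u τ x‖) 0 *
        (fderiv ℝ (normalisedPressure (u τ)) x (u τ x))) ≤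
      Real.sqrt (K ^ 2 * (∫⁻ τ in Ioo 0 T, volume {x | c < ‖u τ x‖}).toReal) *
        Real.sqrt ((∫⁻ τ in Ioo 0 T, ∫⁻ x, {x | c < ‖u τ x‖}.indicator
          (fun x => ENNReal.ofReal (‖fderiv ℝ (fun y => ‖u τ y‖) x‖ ^ 2)) x).toReal) := by
  -- names
  set V : ℝ≥0∞ := ∫⁻ τ in Ioo 0 T, volume {x | c < ‖u τ x‖} with hV
  set D : ℝ≥0∞ := ∫⁻ τ in Ioo 0 T, ∫⁻ x, {x | c < ‖u τ x‖}.indicator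
    (fun x => ENNReal.ofReal (‖fderiv ℝ (fun y => ‖u τ y‖) x‖ ^ 2)) x with hDdef
  set S : ℝ → ℝ≥0∞ := fun τ => ∫⁻ x, {x | c < ‖u τ x‖}.indicator
    (fun x => ENNReal.ofReal ‖fderiv ℝ (fun y => ‖u τ y‖) x‖) x with hS
  set P : ℝ → ℝ := fun τ => ∫ x, max (1 - c / ‖u τ x‖) 0 *
    (fderiv ℝ (normalisedPressure (u τ)) x (u τ x)) with hP
  have hVfin : V ≠ ⊤ :=
    ne_top_of_le_ne_top ENNReal.ofReal_ne_top (levelSetVolume_le hLH hν.le hT.le hc)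
  have hDfin : D ≠ ⊤ := (levelSetDissipation_ne_top hcl hLH hT hν.le hc.le).1
  have hAfin : ∫⁻ τ in Ioo 0 T, S τ ≠ ⊤ := levelSetModeration_isoSpeedArea_ne_top hν hT hcl hLH hc
  -- (a) the moderated slice inequality for every `τ ∈ (s, t)`
  have hslice : ∀ τ ∈ Ioo s t, -P τ ≤ K * (S τ).toReal := by
    intro τ hτ
    have hτT : τ ∈ Ioo 0 T := ⟨hs.trans_lt hτ.1, hτ.2.trans ht.2⟩
    have hτ' : τ ∈ Ico 0 T := ⟨hτT.1.le, hτT.2⟩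
    have hv : ContDiff ℝ 1 (u τ) := (hcl.contDiff_velocity hτ').of_le (by norm_cast)
    have hq : ContDiff ℝ 1 (normalisedPressure (u τ)) :=
      (levelSetModeration_contDiff_normalisedPressure_slice hcl hLH hν.le hτT).of_le (by norm_cast)
    have hdiv : VectorCalculus.IsDivFree (u τ) := hcl.divFree τ hτ'
    have hbdd : Bornology.IsBounded {x | c < ‖u τ x‖} :=
      levelSetModeration_isBounded_superlevel ν T u p hν hcl hLH hdec τ hτ' c hc
    exact levelSetModeration_moderatedSlicePairing_le hc hv hq hdiv hbdd (hK τ hτ)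
  -- (b) measurability, finiteness and the real time integral of the area slices
  have hsub_t : Ioo s t ⊆ Ioo 0 t := Ioo_subset_Ioo hs le_rfl
  have hSmeas : AEMeasurable S (volume.restrict (Ioo s t)) :=
    (levelSetModeration_aemeasurable_areaSlice hcl.smooth_velocity hc ht.2.le).mono_measure
      (Measure.restrict_mono hsub_t le_rfl)
  have hsubT : Ioo s t ⊆ Ioo 0 T := Ioo_subset_Ioo hs ht.2.le
  have hAt_le : ∫⁻ τ in Ioo s t, S τ ≤ ∫⁻ τ in Ioo 0 T, S τ := lintegral_mono_set hsubT
  have hAtfin : ∫⁻ τ in Ioo s t, S τ ≠ ⊤ := ne_top_of_le_ne_top hAfin hAt_le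
  have hSint : Integrable (fun τ => (S τ).toReal) (volume.restrict (Ioo s t)) :=
    integrable_toReal_of_lintegral_ne_top hSmeas hAtfin
  have hSreal : ∫ τ in Ioo s t, (S τ).toReal = (∫⁻ τ in Ioo s t, S τ).toReal :=
    integral_toReal hSmeas (ae_lt_top' hSmeas hAtfin)
  -- (c) `-∫ P ≤ K ∫ S`
  have hmain : -(∫ τ in Ioo s t, P τ) ≤ K * (∫⁻ τ in Ioo s t, S τ).toReal := by
    rw [← integral_neg, ← hSreal, ← integral_const_mul]
    have hKS : Integrable (fun τ => K * (S τ).toReal) (volume.restrict (Ioo s t)) :=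
      hSint.const_mul K
    by_cases hInt : Integrable (fun τ => -P τ) (volume.restrict (Ioo s t))
    · refine integral_mono_ae hInt hKS ?_
      filter_upwards [ae_restrict_mem measurableSet_Ioo] with τ hτ
      exact hslice τ hτ
    · rw [integral_undef hInt]
      exact integral_nonneg fun τ => mul_nonneg hK0 ENNReal.toReal_nonneg
  -- (d) Cauchy–Schwarz `𝒟¹_c(T) ≤ √V √D` in real form
  have hCS := levelSetModeration_isoSpeedArea_le_sqrt hcl.smooth_velocity hc (T := T)
  have hCSr : (∫⁻ τ in Ioo 0 T, S τ).toReal ≤ Real.sqrt V.toReal * Real.sqrt D.toReal := by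
    have h1 := ENNReal.toReal_mono (ENNReal.mul_ne_top
      (ENNReal.rpow_ne_top_of_nonneg (by norm_num) hVfin)
      (ENNReal.rpow_ne_top_of_nonneg (by norm_num) hDfin)) hCS
    rwa [ENNReal.toReal_mul, ← ENNReal.toReal_rpow, ← ENNReal.toReal_rpow, ← Real.sqrt_eq_rpow,
      ← Real.sqrt_eq_rpow] at h1
  have hAt_real : (∫⁻ τ in Ioo s t, S τ).toReal ≤ (∫⁻ τ in Ioo 0 T, S τ).toReal :=
    ENNReal.toReal_mono hAfin hAt_le
  -- (e) assemble: `K √V √D = √(K² V) √D`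
  have hsq : Real.sqrt (K ^ 2 * V.toReal) = K * Real.sqrt V.toReal := by
    rw [Real.sqrt_mul (sq_nonneg K), Real.sqrt_sq hK0]
  calc -(∫ τ in Ioo s t, P τ) ≤ K * (∫⁻ τ in Ioo s t, S τ).toReal := hmain
    _ ≤ K * (∫⁻ τ in Ioo 0 T, S τ).toReal := mul_le_mul_of_nonneg_left hAt_real hK0
    _ ≤ K * (Real.sqrt V.toReal * Real.sqrt D.toReal) := mul_le_mul_of_nonneg_left hCSr hK0
    _ = Real.sqrt (K ^ 2 * V.toReal) * Real.sqrt D.toReal := by rw [hsq]; ring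

/-- **The pairing bound from a moderated pressure bound on the fast set** (registered sub-goal of
the crux item stmt-NavierStokesRegularity-18149, closed form of
`levelSetModeration_moderatedPairing_le`): for a classical Leray–Hopf solution on `ℝ³ × [0,T)`
from a rapidly decaying datum, `c > 0`, `0 ≤ s`, `t ∈ [0,T)`, `K ≥ 0` and any `Φ : ℝ → ℝ`, a bound
`|p̃[u τ] - Φ(τ)| ≤ K` on the fast set `{c < |u τ|}` for all `τ ∈ (s,t)` gives
`-∫ₛᵗ∫ (1 - c/|u|)₊ D(p̃[u τ])(u) ≤ √(K² V_c(T)) √(D_c(T))` (Tran–Yu moderation of the De Giorgi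
pressure pairing by a constant per slice). [folklore] -/
theorem levelSetModeration_pairing_le_of_moderatedPressureBound : ∀ (ν T : ℝ) (u : ℝ → EuclideanSpace ℝ (Fin 3) → EuclideanSpace ℝ (Fin 3)) (p : ℝ → EuclideanSpace ℝ (Fin 3) → ℝ), 0 < ν → 0 < T → Literature.Analysis.FluidPDE.IsClassicalNSSolutionOn (Set.Ico 0 T) ν 0 u p → Literature.Analysis.FluidPDE.IsLerayHopfOn T ν 0 (u 0) u → Literature.Analysis.FluidPDE.HasRapidSpatialDecay (u 0) → ∀ (c s t K : ℝ) (Φ : ℝ → ℝ), 0 < c → 0 ≤ s → t ∈ Set.Ico 0 T → 0 ≤ K → (∀ τ ∈ Set.Ioo s t, ∀ x, c < ‖u τ x‖ → |Literature.Analysis.FluidPDE.normalisedPressure (u τ) x - Φ τ| ≤ K) → -(∫ τ in Set.Ioo s t, ∫ x, max (1 - c / ‖u τ x‖) 0 * (fderiv ℝ (Literature.Analysis.FluidPDE.normalisedPressure (u τ)) x (u τ x))) ≤ Real.sqrt (K ^ 2 * (∫⁻ τ in Set.Ioo 0 T, MeasureTheory.volume {x | c < ‖u τ x‖}).toReal)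 * Real.sqrt ((∫⁻ τ in Set.Ioo 0 T, ∫⁻ x, Set.indicator {x | c < ‖u τ x‖} (fun x => ENNReal.ofReal (‖fderiv ℝ (fun y => ‖u τ y‖) x‖ ^ 2)) x).toReal) :=
  fun _ _ _ _ hν hT hcl hLH hdec _ _ _ _ _ hc hs ht hK0 hK =>
    levelSetModeration_moderatedPairing_le hν hT hcl hLH hdec hc hs ht hK0 hK

end Summit.NavierStokesRegularity.NavierStokesRegularity.Theorems

end
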